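import Mathlib
import Summits.Ventures.PercRepro2.TypedFourCycleStates

/-!
# The root edge at `o` is worth nothing beside the type-2 four-cycle `a₁ – b – o – a₃ – a₂`
(blind cell PercRepro2, night-3 g19, 2026-08-28; `proofs/NIGHT3-CERT.md` §28; the states and the
four terms are in `TypedFourCycleStates.lean`)

With `f₁ = {a₁, b}`, `f₂ = {o, b}`, `f₃ = {o, a₃}`, `f₄ = {a₂, a₃}` typed edges of type `2`, adding
a NEW edge `e = {a₁, o}` of type `1` does not change the typed base of `K₃`:

  `typedCount (insert e F) z (τ[e := 1]) K₃ = typedCount F z τ K₃`   (`typedCount_root_edge_of_four_cycle`)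

— the twenty «unexplained» equality cases of (ROOT-MONO-o) at `a ≤ 5` on distinct marks
(§27.16), proved. MECHANISM (symmetrised-pointwise on the kernel `KBsym` on states): each of the
four edges is closed in exactly one copy. A copy carrying `f₁, f₂` has `o ∈ C(a₁)` — opening `e`
there changes nothing; a copy carrying `f₃, f₄` has `o ∈ C(a₂)` — opening `e` there joins the
roots and kills the term; a copy carrying exactly one of `f₁, f₂` and one of `f₃, f₄` is MIXED:
once `e` is opened it carries `o, a₃ ∈ C(a₁)` or `o, b ∈ C(a₁), a₃ ∈ C(a₂)`, the copy carrying
`f₃, f₄` has `o, a₃ ∈ C(a₂)`, and the copy carrying `f₁, f₂` and the remaining edge supplies the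
third state of g18's three-copy rule `KBsym_eq_zero_of_Lo3_H3_Ho3` — so the mixed placement
vanishes. Counting the copies with `o ∈ C(a₁)`: one (the sum of the three placements is the
term without `e`), or two (then the third copy carries `f₃, f₄` and the three states are again
the rule's — the term without `e` vanishes, and so do all placements), or some copy carries all
four edges (`a₁ ↔ a₂` there: everything vanishes). Own work; standard axioms.
-/

namespace Summit.Ventures.PercRepro2

open UnionCluster

namespace CovForm

namespace Triangle

open OneTyped Untouched CoincRoot TypedRed

section Main

open Classical

variable {V : Type*} {E : Type*} [Fintype E] [DecidableEq E] {R : Type*} [Field R]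
  [LinearOrder R] [IsStrictOrderedRing R]
variable (ends : E → Sym2 V) (o a₁ a₂ a₃ b : V)

/-! ## The core pointwise identity -/

omit [Fintype E] [LinearOrder R] [IsStrictOrderedRing R] in
/-- Opening `e = {a₁, o}` joins `a₁` and `o`. -/
lemma conn_update_a1_o {e : E} (he : ends e = s(a₁, o)) (u : Config E) :
    Conn ends (Function.update u e true) a₁ o :=
  conn_of_openAdj ⟨e, Function.update_self e true u, he⟩

omit [Fintype E] [LinearOrder R] [IsStrictOrderedRing R] in
/-- Connections survive the opening of an edge. -/
lemma conn_update_of {e : E} (u : Config E) {p q : V} (hc : Conn ends u p q) :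
    Conn ends (Function.update u e true) p q :=
  conn_mono (le_update_true u e) hc

omit [Fintype E] [DecidableEq E] [LinearOrder R] [IsStrictOrderedRing R] in
/-- `o ∈ C(a₁)` and `f₃ = {o, a₃}` open give `a₃ ∈ C(a₁)`. -/
lemma conn_a1_a3_of_f3 {f₃ : E} (h3 : ends f₃ = s(o, a₃)) (u : Config E) (huo : Conn ends u a₁ o)
    (hu3 : u f₃ = true) : Conn ends u a₁ a₃ :=
  conn_trans huo (conn_of_openAdj ⟨f₃, hu3, h3⟩)

omit [Fintype E] [LinearOrder R] [IsStrictOrderedRing R] in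
/-- **The core identity** with the first copy carrying `f₁, f₂` and the second carrying `f₁`. -/
lemma four_cycle_core {e f₁ f₂ f₃ f₄ : E} (he : ends e = s(a₁, o)) (h1 : ends f₁ = s(a₁, b))
    (h2 : ends f₂ = s(o, b)) (h3 : ends f₃ = s(o, a₃)) (h4 : ends f₄ = s(a₂, a₃))
    (x y w : Config E)
    (s1 : (x f₁).toNat + (y f₁).toNat + (w f₁).toNat = 2)
    (s2 : (x f₂).toNat + (y f₂).toNat + (w f₂).toNat = 2)
    (s3 : (x f₃).toNat + (y f₃).toNat + (w f₃).toNat = 2)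
    (s4 : (x f₄).toNat + (y f₄).toNat + (w f₄).toNat = 2)
    (hx1 : x f₁ = true) (hx2 : x f₂ = true) (hy1 : y f₁ = true) :
    T₁ ends o a₁ a₂ a₃ b e x y w + T₂ ends o a₁ a₂ a₃ b e x y w + T₃ ends o a₁ a₂ a₃ b e x y w =
      T₀ ends o a₁ a₂ a₃ b x y w := by
  have hxo : Conn ends x a₁ o := conn_a1_o_of_f12 ends o a₁ b h1 h2 x hx1 hx2
  have hT1 := T₁_eq_of_conn ends o a₁ a₂ a₃ b he x y w hxo
  -- the four edges of the other copies
  have c4 : ∀ u : Config E, u f₄ = true → Conn ends u a₂ a₃ := fun u hu =>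
    conn_of_openAdj ⟨f₄, hu, h4⟩
  have c3 : ∀ u : Config E, u f₃ = true → Conn ends u o a₃ := fun u hu =>
    conn_of_openAdj ⟨f₃, hu, h3⟩
  have c2 : ∀ u : Config E, u f₂ = true → Conn ends u o b := fun u hu =>
    conn_of_openAdj ⟨f₂, hu, h2⟩
  have c34 : ∀ u : Config E, u f₃ = true → u f₄ = true → Conn ends u a₂ o := fun u h3' h4' =>
    conn_a2_o_of_f34 ends o a₂ a₃ h3 h4 u h3' h4'
  have cup : ∀ u : Config E, Conn ends (Function.update u e true) a₁ o := fun u =>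
    conn_update_a1_o ends o a₁ he u
  have cup3 : ∀ u : Config E, u f₃ = true → Conn ends (Function.update u e true) a₁ a₃ :=
    fun u hu => conn_trans (cup u) (conn_update_of ends u (c3 u hu))
  have cup4 : ∀ u : Config E, u f₄ = true → Conn ends (Function.update u e true) a₂ a₃ :=
    fun u hu => conn_update_of ends u (c4 u hu)
  have hw1 : w f₁ = false := third_false s1 hx1 hy1
  cases hy2 : y f₂
  · -- `y` misses `f₂`, `w` carries it
    have hw2 : w f₂ = true := third_true s2 hx2 hy2
    rcases two_of_three_cases s3 with ⟨hx3, hy3, hw3⟩ | ⟨hx3, hy3, hw3⟩ | ⟨hx3, hy3, hw3⟩ <;>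
      rcases two_of_three_cases s4 with ⟨hx4, hy4, hw4⟩ | ⟨hx4, hy4, hw4⟩ | ⟨hx4, hy4, hw4⟩
    · -- y: 1,3,4 ; w: 2,3,4
      rw [hT1, T₂_eq_zero_of_conn ends o a₁ a₂ a₃ b he x y w (c34 y hy3 hy4),
        T₃_eq_zero_of_conn ends o a₁ a₂ a₃ b he x y w (c34 w hw3 hw4)]
      ring
    · -- y: 1,3 (mixed) ; w: 2,3,4 ; x: 1,2,4
      have hT3 := T₃_eq_zero_of_conn ends o a₁ a₂ a₃ b he x y w (c34 w hw3 hw4)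
      have hT2 : T₂ ends o a₁ a₂ a₃ b e x y w = 0 := by
        unfold T₂
        rw [KBsym_comm_left]
        exact KBsym_st_eq_zero_of_Lo3_H3_Ho3 ends o a₁ a₂ a₃ b _ x w (cup y) (cup3 y hy3)
          (c4 x hx4) (c34 w hw3 hw4) (c4 w hw4)
      rw [hT1, hT2, hT3]; ring
    · -- y: 1,3,4 ; w: 2,3 (mixed) ; x: 1,2,4
      have hT2 := T₂_eq_zero_of_conn ends o a₁ a₂ a₃ b he x y w (c34 y hy3 hy4)
      have hT3 : T₃ ends o a₁ a₂ a₃ b e x y w = 0 := by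
        unfold T₃
        rw [KBsym_comm_right, KBsym_comm_left]
        exact KBsym_st_eq_zero_of_Lo3_H3_Ho3 ends o a₁ a₂ a₃ b _ x y (cup w) (cup3 w hw3)
          (c4 x hx4) (c34 y hy3 hy4) (c4 y hy4)
      rw [hT1, hT2, hT3]; ring
    · -- y: 1,4 (mixed) ; w: 2,3,4 ; x: 1,2,3
      have hT3 := T₃_eq_zero_of_conn ends o a₁ a₂ a₃ b he x y w (c34 w hw3 hw4)
      have hT2 : T₂ ends o a₁ a₂ a₃ b e x y w = 0 := by
        unfold T₂
        exact KBsym_st_eq_zero_of_Lo3_H3_Ho3 ends o a₁ a₂ a₃ b x _ w hxo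
          (conn_a1_a3_of_f3 ends o a₁ a₃ h3 x hxo hx3) (cup4 y hy4) (c34 w hw3 hw4) (c4 w hw4)
      rw [hT1, hT2, hT3]; ring
    · exact all_zero_of_x ends o a₁ a₂ a₃ b x y w
        (conn_roots_of_four ends o a₁ a₂ a₃ b h1 h2 h3 h4 x hx1 hx2 hx3 hx4)
    · exact all_zero_of_x ends o a₁ a₂ a₃ b x y w
        (conn_roots_of_four ends o a₁ a₂ a₃ b h1 h2 h3 h4 x hx1 hx2 hx3 hx4)
    · -- y: 1,3,4 ; w: 2,4 (mixed) ; x: 1,2,3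
      have hT2 := T₂_eq_zero_of_conn ends o a₁ a₂ a₃ b he x y w (c34 y hy3 hy4)
      have hT3 : T₃ ends o a₁ a₂ a₃ b e x y w = 0 := by
        unfold T₃
        rw [KBsym_comm_right]
        exact KBsym_st_eq_zero_of_Lo3_H3_Ho3 ends o a₁ a₂ a₃ b x _ y hxo
          (conn_a1_a3_of_f3 ends o a₁ a₃ h3 x hxo hx3) (cup4 w hw4) (c34 y hy3 hy4) (c4 y hy4)
      rw [hT1, hT2, hT3]; ring
    · exact all_zero_of_x ends o a₁ a₂ a₃ b x y w
        (conn_roots_of_four ends o a₁ a₂ a₃ b h1 h2 h3 h4 x hx1 hx2 hx3 hx4)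
    · exact all_zero_of_x ends o a₁ a₂ a₃ b x y w
        (conn_roots_of_four ends o a₁ a₂ a₃ b h1 h2 h3 h4 x hx1 hx2 hx3 hx4)
  · -- `y` carries `f₁, f₂` as well; `w` misses both
    have hw2 : w f₂ = false := third_false s2 hx2 hy2
    have hyo : Conn ends y a₁ o := conn_a1_o_of_f12 ends o a₁ b h1 h2 y hy1 hy2
    have hT2 := T₂_eq_of_conn ends o a₁ a₂ a₃ b he x y w hyo
    rcases two_of_three_cases s3 with ⟨hx3, hy3, hw3⟩ | ⟨hx3, hy3, hw3⟩ | ⟨hx3, hy3, hw3⟩ <;>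
      rcases two_of_three_cases s4 with ⟨hx4, hy4, hw4⟩ | ⟨hx4, hy4, hw4⟩ | ⟨hx4, hy4, hw4⟩
    · exact all_zero_of_y ends o a₁ a₂ a₃ b x y w
        (conn_roots_of_four ends o a₁ a₂ a₃ b h1 h2 h3 h4 y hy1 hy2 hy3 hy4)
    · -- x: 1,2,4 ; y: 1,2,3 ; w: 3,4 — the term without `e` vanishes
      have hT3 := T₃_eq_zero_of_conn ends o a₁ a₂ a₃ b he x y w (c34 w hw3 hw4)
      have hT0 : T₀ ends o a₁ a₂ a₃ b x y w = 0 := by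
        unfold T₀
        rw [KBsym_comm_left]
        exact KBsym_st_eq_zero_of_Lo3_H3_Ho3 ends o a₁ a₂ a₃ b y x w hyo
          (conn_a1_a3_of_f3 ends o a₁ a₃ h3 y hyo hy3) (c4 x hx4) (c34 w hw3 hw4) (c4 w hw4)
      rw [hT1, hT2, hT3, hT0]; ring
    · exact all_zero_of_y ends o a₁ a₂ a₃ b x y w
        (conn_roots_of_four ends o a₁ a₂ a₃ b h1 h2 h3 h4 y hy1 hy2 hy3 hy4)
    · -- x: 1,2,3 ; y: 1,2,4 ; w: 3,4
      have hT3 := T₃_eq_zero_of_conn ends o a₁ a₂ a₃ b he x y w (c34 w hw3 hw4)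
      have hT0 : T₀ ends o a₁ a₂ a₃ b x y w = 0 := by
        unfold T₀
        exact KBsym_st_eq_zero_of_Lo3_H3_Ho3 ends o a₁ a₂ a₃ b x y w hxo
          (conn_a1_a3_of_f3 ends o a₁ a₃ h3 x hxo hx3) (c4 y hy4) (c34 w hw3 hw4) (c4 w hw4)
      rw [hT1, hT2, hT3, hT0]; ring
    · exact all_zero_of_x ends o a₁ a₂ a₃ b x y w
        (conn_roots_of_four ends o a₁ a₂ a₃ b h1 h2 h3 h4 x hx1 hx2 hx3 hx4)
    · exact all_zero_of_x ends o a₁ a₂ a₃ b x y w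
        (conn_roots_of_four ends o a₁ a₂ a₃ b h1 h2 h3 h4 x hx1 hx2 hx3 hx4)
    · exact all_zero_of_y ends o a₁ a₂ a₃ b x y w
        (conn_roots_of_four ends o a₁ a₂ a₃ b h1 h2 h3 h4 y hy1 hy2 hy3 hy4)
    · exact all_zero_of_x ends o a₁ a₂ a₃ b x y w
        (conn_roots_of_four ends o a₁ a₂ a₃ b h1 h2 h3 h4 x hx1 hx2 hx3 hx4)
    · exact all_zero_of_x ends o a₁ a₂ a₃ b x y w
        (conn_roots_of_four ends o a₁ a₂ a₃ b h1 h2 h3 h4 x hx1 hx2 hx3 hx4)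

/-! ## Symmetry in the copies, and the identity on the whole support -/

omit [Fintype E] [LinearOrder R] [IsStrictOrderedRing R] in
/-- The identity is symmetric under swapping the first two copies. -/
lemma id_swap12 {e : E} (x y w : Config E)
    (h : T₁ ends o a₁ a₂ a₃ b e y x w + T₂ ends o a₁ a₂ a₃ b e y x w +
      T₃ ends o a₁ a₂ a₃ b e y x w = T₀ ends o a₁ a₂ a₃ b y x w) :
    T₁ ends o a₁ a₂ a₃ b e x y w + T₂ ends o a₁ a₂ a₃ b e x y w + T₃ ends o a₁ a₂ a₃ b e x y w =
      T₀ ends o a₁ a₂ a₃ b x y w := by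
  unfold T₁ T₂ T₃ T₀ at h ⊢
  rw [KBsym_comm_left (st ends o a₁ a₂ a₃ b (Function.update y e true)),
    KBsym_comm_left (st ends o a₁ a₂ a₃ b y) (st ends o a₁ a₂ a₃ b (Function.update x e true)),
    KBsym_comm_left (st ends o a₁ a₂ a₃ b y) (st ends o a₁ a₂ a₃ b x)
      (st ends o a₁ a₂ a₃ b (Function.update w e true)),
    KBsym_comm_left (st ends o a₁ a₂ a₃ b y) (st ends o a₁ a₂ a₃ b x)] at h
  linarith

omit [Fintype E] [LinearOrder R] [IsStrictOrderedRing R] in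
/-- The identity is symmetric under swapping the last two copies. -/
lemma id_swap23 {e : E} (x y w : Config E)
    (h : T₁ ends o a₁ a₂ a₃ b e x w y + T₂ ends o a₁ a₂ a₃ b e x w y +
      T₃ ends o a₁ a₂ a₃ b e x w y = T₀ ends o a₁ a₂ a₃ b x w y) :
    T₁ ends o a₁ a₂ a₃ b e x y w + T₂ ends o a₁ a₂ a₃ b e x y w + T₃ ends o a₁ a₂ a₃ b e x y w =
      T₀ ends o a₁ a₂ a₃ b x y w := by
  unfold T₁ T₂ T₃ T₀ at h ⊢
  rw [KBsym_comm_right (st ends o a₁ a₂ a₃ b (Function.update x e true)),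
    KBsym_comm_right (st ends o a₁ a₂ a₃ b x) (st ends o a₁ a₂ a₃ b (Function.update w e true)),
    KBsym_comm_right (st ends o a₁ a₂ a₃ b x) (st ends o a₁ a₂ a₃ b w)
      (st ends o a₁ a₂ a₃ b (Function.update y e true)),
    KBsym_comm_right (st ends o a₁ a₂ a₃ b x) (st ends o a₁ a₂ a₃ b w)] at h
  linarith

omit [Fintype E] [LinearOrder R] [IsStrictOrderedRing R] in
/-- **The pointwise identity on the support**: the three placements of the new root edge sum to
the term without it, for every triple in which each cycle edge is open in exactly two copies. -/
lemma four_cycle_placements_eq {e f₁ f₂ f₃ f₄ : E} (he : ends e = s(a₁, o))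
    (h1 : ends f₁ = s(a₁, b)) (h2 : ends f₂ = s(o, b)) (h3 : ends f₃ = s(o, a₃))
    (h4 : ends f₄ = s(a₂, a₃)) (x y w : Config E)
    (s1 : (x f₁).toNat + (y f₁).toNat + (w f₁).toNat = 2)
    (s2 : (x f₂).toNat + (y f₂).toNat + (w f₂).toNat = 2)
    (s3 : (x f₃).toNat + (y f₃).toNat + (w f₃).toNat = 2)
    (s4 : (x f₄).toNat + (y f₄).toNat + (w f₄).toNat = 2) :
    T₁ ends o a₁ a₂ a₃ b e x y w + T₂ ends o a₁ a₂ a₃ b e x y w + T₃ ends o a₁ a₂ a₃ b e x y w =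
      T₀ ends o a₁ a₂ a₃ b x y w := by
  have p1 : ∀ u v : Config E, (u f₁).toNat + (v f₁).toNat + (x f₁).toNat = 2 →
      (x f₁).toNat + (u f₁).toNat + (v f₁).toNat = 2 := fun u v h => by rw [← h]; ring
  rcases some_copy_both_first s1 s2 with ⟨hx1, hx2, hy1 | hw1⟩ | ⟨hy1, hy2, hx1 | hw1⟩ |
    ⟨hw1, hw2, hx1 | hy1⟩
  · exact four_cycle_core ends o a₁ a₂ a₃ b he h1 h2 h3 h4 x y w s1 s2 s3 s4 hx1 hx2 hy1
  · refine id_swap23 ends o a₁ a₂ a₃ b x y w ?_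
    exact four_cycle_core ends o a₁ a₂ a₃ b he h1 h2 h3 h4 x w y (by rw [← s1]; ring)
      (by rw [← s2]; ring) (by rw [← s3]; ring) (by rw [← s4]; ring) hx1 hx2 hw1
  · refine id_swap12 ends o a₁ a₂ a₃ b x y w ?_
    exact four_cycle_core ends o a₁ a₂ a₃ b he h1 h2 h3 h4 y x w (by rw [← s1]; ring)
      (by rw [← s2]; ring) (by rw [← s3]; ring) (by rw [← s4]; ring) hy1 hy2 hx1
  · refine id_swap12 ends o a₁ a₂ a₃ b x y w (id_swap23 ends o a₁ a₂ a₃ b y x w ?_)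
    exact four_cycle_core ends o a₁ a₂ a₃ b he h1 h2 h3 h4 y w x (by rw [← s1]; ring)
      (by rw [← s2]; ring) (by rw [← s3]; ring) (by rw [← s4]; ring) hy1 hy2 hw1
  · refine id_swap23 ends o a₁ a₂ a₃ b x y w (id_swap12 ends o a₁ a₂ a₃ b x w y ?_)
    exact four_cycle_core ends o a₁ a₂ a₃ b he h1 h2 h3 h4 w x y (by rw [← s1]; ring)
      (by rw [← s2]; ring) (by rw [← s3]; ring) (by rw [← s4]; ring) hw1 hw2 hx1
  · refine id_swap12 ends o a₁ a₂ a₃ b x y w (id_swap23 ends o a₁ a₂ a₃ b y x w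
      (id_swap12 ends o a₁ a₂ a₃ b y w x ?_))
    exact four_cycle_core ends o a₁ a₂ a₃ b he h1 h2 h3 h4 w y x (by rw [← s1]; ring)
      (by rw [← s2]; ring) (by rw [← s3]; ring) (by rw [← s4]; ring) hw1 hw2 hy1

/-! ## The theorem -/

/-- **The root edge at `o` beside the type-2 four-cycle `a₁ – b – o – a₃ – a₂` is worth nothing**:
with `f₁ = {a₁, b}`, `f₂ = {o, b}`, `f₃ = {o, a₃}`, `f₄ = {a₂, a₃}` in `F` of type `2`, adding the
new edge `e = {a₁, o}` of type `1` leaves the typed base unchanged. -/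
theorem typedCount_root_edge_of_four_cycle {e f₁ f₂ f₃ f₄ : E} (he : ends e = s(a₁, o))
    (h1 : ends f₁ = s(a₁, b)) (h2 : ends f₂ = s(o, b)) (h3 : ends f₃ = s(o, a₃))
    (h4 : ends f₄ = s(a₂, a₃)) (F : Finset E) (heF : e ∉ F) (h1F : f₁ ∈ F) (h2F : f₂ ∈ F)
    (h3F : f₃ ∈ F) (h4F : f₄ ∈ F) (z : Config E) (hze : z e = false) (τ : E → ℕ)
    (hτ : ∀ e' ∈ F, τ e' = 1 ∨ τ e' = 2) (hτ1 : τ f₁ = 2) (hτ2 : τ f₂ = 2) (hτ3 : τ f₃ = 2)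
    (hτ4 : τ f₄ = 2) :
    typedCount (insert e F) z (Function.update τ e 1)
        (K3 ends o a₁ a₂ a₃ b : Config E → Config E → Config E → R) =
      typedCount F z τ (K3 ends o a₁ a₂ a₃ b) := by
  have hτ' : ∀ e' ∈ insert e F, Function.update τ e 1 e' = 1 ∨ Function.update τ e 1 e' = 2 := by
    intro e' he'
    rcases Finset.mem_insert.1 he' with rfl | he'
    · left; exact Function.update_self _ _ _
    · rw [Function.update_of_ne (fun h => heF (by rw [← h]; exact he'))]
      exact hτ e' he'
  have hcτ : ∀ K : Config E → Config E → Config E → R,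
      typedCount F z (Function.update τ e 1) K = typedCount F z τ K := fun K =>
    typedCount_congr_τ F z (fun e' he' => Function.update_of_ne (fun h => heF (by rw [← h]; exact he')) _ _) K
  have h6L := six_mul_typedCount_KBsym'' (R := R) ends o a₁ a₂ a₃ b (insert e F) z
    (Function.update τ e 1) hτ'
  have h6R := six_mul_typedCount_KBsym'' (R := R) ends o a₁ a₂ a₃ b F z τ hτ
  set KS : Config E → Config E → Config E → R := fun x y w =>
    ((KBsym (st ends o a₁ a₂ a₃ b x) (st ends o a₁ a₂ a₃ b y) (st ends o a₁ a₂ a₃ b w) : ℤ) : R)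
    with hKS
  have hsplit := typedCount_split (insert e F) e (Finset.mem_insert_self e F) z
    (Function.update τ e 1) KS
  have hz : Function.update z e false = z := by
    rw [← hze]; exact Function.update_eq_self e z
  rw [Function.update_self, Finset.erase_insert heF, hz, sum_bool3_one_rp, hcτ, hcτ, hcτ,
    ← TypedRed.typedCount_add, ← TypedRed.typedCount_add] at hsplit
  -- the pointwise identity on the support of the right count
  have hpt : typedCount F z τ (fun x y w =>
      KS (Function.update x e true) (Function.update y e false) (Function.update w e false) +
      KS (Function.update x e false) (Function.update y e true) (Function.update w e false) +
      KS (Function.update x e false) (Function.update y e false) (Function.update w e true)) =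
      typedCount F z τ KS := by
    refine typedCount_congr_on_support F z τ fun x y w hoff hτ'' => ?_
    have hx : Function.update x e false = x := by
      have h : x e = false := (hoff e heF).1.trans hze
      rw [← h]; exact Function.update_eq_self e x
    have hy : Function.update y e false = y := by
      have h : y e = false := (hoff e heF).2.1.trans hze
      rw [← h]; exact Function.update_eq_self e y
    have hw : Function.update w e false = w := by
      have h : w e = false := (hoff e heF).2.2.trans hze
      rw [← h]; exact Function.update_eq_self e w
    rw [hx, hy, hw]
    have s1 := hτ'' f₁ h1F
    have s2 := hτ'' f₂ h2F
    have s3 := hτ'' f₃ h3F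
    have s4 := hτ'' f₄ h4F
    rw [hτ1] at s1
    rw [hτ2] at s2
    rw [hτ3] at s3
    rw [hτ4] at s4
    unfold openCount at s1 s2 s3 s4
    have := four_cycle_placements_eq ends o a₁ a₂ a₃ b he h1 h2 h3 h4 x y w s1 s2 s3 s4
    simp only [hKS]
    exact_mod_cast this
  rw [hpt] at hsplit
  rw [hsplit, ← h6R] at h6L
  have h6' : (6 : R) ≠ 0 := by norm_num
  exact mul_left_cancel₀ h6' h6L

/-- **The four-cycle is an equality case of (ROOT-MONO-o)**: the new root edge does not decrease
the typed base (it leaves it unchanged). -/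
theorem rootMonoO_of_four_cycle {e f₁ f₂ f₃ f₄ : E} (he : ends e = s(a₁, o))
    (h1 : ends f₁ = s(a₁, b)) (h2 : ends f₂ = s(o, b)) (h3 : ends f₃ = s(o, a₃))
    (h4 : ends f₄ = s(a₂, a₃)) (F : Finset E) (heF : e ∉ F) (h1F : f₁ ∈ F) (h2F : f₂ ∈ F)
    (h3F : f₃ ∈ F) (h4F : f₄ ∈ F) (z : Config E) (hze : z e = false) (τ : E → ℕ)
    (hτ : ∀ e' ∈ F, τ e' = 1 ∨ τ e' = 2) (hτ1 : τ f₁ = 2) (hτ2 : τ f₂ = 2) (hτ3 : τ f₃ = 2)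
    (hτ4 : τ f₄ = 2) :
    typedCount F z τ (K3 ends o a₁ a₂ a₃ b : Config E → Config E → Config E → R) ≤
      typedCount (insert e F) z (Function.update τ e 1) (K3 ends o a₁ a₂ a₃ b) :=
  le_of_eq (typedCount_root_edge_of_four_cycle ends o a₁ a₂ a₃ b he h1 h2 h3 h4 F heF h1F h2F
    h3F h4F z hze τ hτ hτ1 hτ2 hτ3 hτ4).symm

end Main

end Triangle

end CovForm

end Summit.Ventures.PercRepro2
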